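import Mathlib
import Literature.MathematicalPhysics.QuantumFieldTheory.StrongCouplingInfiniteVolume

/-!
# LatticeQCDFlow / Scaling — uniform `O(βᵏ)` bookkeeping for parametrised families
# (the analytic toolkit of the slab-chain proof of the leading-coefficient identity (LC) at every
# separation)

HONEST FRAMING: exact (Metropolis-corrected) sampling algorithms for lattice gauge theory;
figures of merit are autocorrelation/cost numbers at stated couplings and volumes; no
continuum-physics claim.

Venture `LatticeQCDFlow` (cell pub-lqcd), topic `Scaling`, FANOUT row 30 (lean-1) — OUR WORK, the
first file of the general-separation leading-coefficient identity (LC) (LEAD LINE 230 (G3′): the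
`t ≥ 1` census, successor of `Scaling/U1LeadingCoefficient.lean`).  The proof expands a product of
slab transfer kernels `∏_h (c_h(β)² + T_h(β, ω))` over subsets of slabs and needs estimates that are
UNIFORM in the configuration `ω` and are then integrated.  This file is that bookkeeping, nothing
else:
* `UnifO k F` — `‖F β a‖ ≤ C ‖β‖ᵏ` for all `a` and all `‖β‖ < r` (one `C`, one `r > 0`);
* closure under `+`, `−`, scalar and `βʲ` multiples, products (`UnifO.mul`, `UnifO.prod`: orders
  add), weakening of the order (`UnifO.mono`), reindexing (`UnifO.comp`), scalar functions
  (`UnifO.of_isBigO`);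
* `UnifO.prod_leading` — if `F_i = βᵏ P_i + UnifO(k+1)` with the `P_i` bounded, then
  `∏_{i∈S} F_i = β^{k #S} ∏ P_i + UnifO(k #S + 1)`;
* `UnifO.isBigO_integral` — integrating a `UnifO k` family against a probability measure gives an
  honest `O(βᵏ)` at `β = 0` (`norm_integral_le_of_norm_le_const`);
* `isBigO_div_sq_sub` — `N − b βᵐ = O(β^{m+1})`, `Z − 1 = O(β)`, `Z⁻¹` bounded near `0` ⇒
  `N / Z² − b βᵐ = O(β^{m+1})` (the covariance is the doubled numerator over the squared
  normaliser).
Elementary; nothing is cited as a fact; one `def` (`UnifO`), no `sorry`.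
-/

noncomputable section

open MeasureTheory Filter Topology Asymptotics Finset
open Literature.MathematicalPhysics.QuantumFieldTheory (JetEq BddAt)

namespace Summit.Ventures.LatticeQCDFlow.Theory2

/-- **Uniform `O(βᵏ)`** for a family `F β a` parametrised by `a`: one constant and one radius serve
all parameters: `∃ C r, 0 < r ∧ ∀ β, ‖β‖ < r → ∀ a, ‖F β a‖ ≤ C ‖β‖ᵏ`. [folklore] -/
def UnifO {α : Type*} (k : ℕ) (F : ℂ → α → ℂ) : Prop :=
  ∃ C r : ℝ, 0 < r ∧ ∀ β : ℂ, ‖β‖ < r → ∀ a, ‖F β a‖ ≤ C * ‖β‖ ^ k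

namespace UnifO

variable {α : Type*} {k j : ℕ} {F G : ℂ → α → ℂ}

/-- The constant may be taken non-negative. [folklore] -/
theorem exists_nonneg (h : UnifO k F) :
    ∃ C r : ℝ, 0 ≤ C ∧ 0 < r ∧ ∀ β : ℂ, ‖β‖ < r → ∀ a, ‖F β a‖ ≤ C * ‖β‖ ^ k := by
  obtain ⟨C, r, hr, h⟩ := h
  refine ⟨max C 0, r, le_max_right _ _, hr, fun β hβ a => (h β hβ a).trans ?_⟩
  exact mul_le_mul_of_nonneg_right (le_max_left _ _) (by positivity)

/-- A uniformly bounded family is `UnifO 0`. [folklore] -/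
theorem of_norm_le {C : ℝ} (h : ∀ β a, ‖F β a‖ ≤ C) : UnifO 0 F :=
  ⟨C, 1, one_pos, fun β _ a => by simpa using h β a⟩

/-- A family bounded on a ball is `UnifO 0`. [folklore] -/
theorem of_norm_le_of_lt {C r : ℝ} (hr : 0 < r) (h : ∀ β : ℂ, ‖β‖ < r → ∀ a, ‖F β a‖ ≤ C) :
    UnifO 0 F :=
  ⟨C, r, hr, fun β hβ a => by simpa using h β hβ a⟩

/-- The zero family is `UnifO k` for every `k`. [folklore] -/
theorem zero : UnifO k (fun (_ : ℂ) (_ : α) => (0 : ℂ)) :=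
  ⟨0, 1, one_pos, fun β _ a => by simp⟩

/-- Weakening the order (near `0`, `‖β‖ʲ ≤ ‖β‖ᵏ` for `k ≤ j`). [folklore] -/
theorem mono (h : UnifO j F) (hkj : k ≤ j) : UnifO k F := by
  obtain ⟨C, r, hC, hr, h⟩ := h.exists_nonneg
  refine ⟨C, min r 1, lt_min hr one_pos, fun β hβ a => ?_⟩
  have hβr : ‖β‖ < r := lt_of_lt_of_le hβ (min_le_left _ _)
  have hβ1 : ‖β‖ ≤ 1 := (lt_of_lt_of_le hβ (min_le_right _ _)).le
  refine (h β hβr a).trans (mul_le_mul_of_nonneg_left ?_ hC)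
  exact pow_le_pow_of_le_one (norm_nonneg _) hβ1 hkj

/-- Sums. [folklore] -/
theorem add (hF : UnifO k F) (hG : UnifO k G) : UnifO k (fun β a => F β a + G β a) := by
  obtain ⟨C₁, r₁, hr₁, h₁⟩ := hF
  obtain ⟨C₂, r₂, hr₂, h₂⟩ := hG
  refine ⟨C₁ + C₂, min r₁ r₂, lt_min hr₁ hr₂, fun β hβ a => ?_⟩
  have e₁ := h₁ β (lt_of_lt_of_le hβ (min_le_left _ _)) a
  have e₂ := h₂ β (lt_of_lt_of_le hβ (min_le_right _ _)) a
  calc ‖F β a + G β a‖ ≤ ‖F β a‖ + ‖G β a‖ := norm_add_le _ _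
    _ ≤ C₁ * ‖β‖ ^ k + C₂ * ‖β‖ ^ k := add_le_add e₁ e₂
    _ = (C₁ + C₂) * ‖β‖ ^ k := by ring

/-- Negation. [folklore] -/
theorem neg (hF : UnifO k F) : UnifO k (fun β a => -F β a) := by
  obtain ⟨C, r, hr, h⟩ := hF
  exact ⟨C, r, hr, fun β hβ a => by rw [norm_neg]; exact h β hβ a⟩

/-- Differences. [folklore] -/
theorem sub (hF : UnifO k F) (hG : UnifO k G) : UnifO k (fun β a => F β a - G β a) := by
  have h := hF.add hG.neg
  simpa [sub_eq_add_neg] using h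

/-- Products: the orders add. [folklore] -/
theorem mul (hF : UnifO j F) (hG : UnifO k G) : UnifO (j + k) (fun β a => F β a * G β a) := by
  obtain ⟨C₁, r₁, hC₁, hr₁, h₁⟩ := hF.exists_nonneg
  obtain ⟨C₂, r₂, _, hr₂, h₂⟩ := hG.exists_nonneg
  refine ⟨C₁ * C₂, min r₁ r₂, lt_min hr₁ hr₂, fun β hβ a => ?_⟩
  have e₁ := h₁ β (lt_of_lt_of_le hβ (min_le_left _ _)) a
  have e₂ := h₂ β (lt_of_lt_of_le hβ (min_le_right _ _)) a
  calc ‖F β a * G β a‖ = ‖F β a‖ * ‖G β a‖ := norm_mul _ _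
    _ ≤ C₁ * ‖β‖ ^ j * (C₂ * ‖β‖ ^ k) :=
        mul_le_mul e₁ e₂ (norm_nonneg _) (by positivity)
    _ = C₁ * C₂ * ‖β‖ ^ (j + k) := by ring

/-- Scalar multiples. [folklore] -/
theorem const_mul (c : ℂ) (hF : UnifO k F) : UnifO k (fun β a => c * F β a) := by
  have hc : UnifO 0 (fun (_ : ℂ) (_ : α) => c) := of_norm_le (C := ‖c‖) fun _ _ => le_rfl
  have h := hc.mul hF
  simpa using h

/-- Multiplication by a power of `β` raises the order. [folklore] -/
theorem pow_mul (j : ℕ) (hF : UnifO k F) : UnifO (j + k) (fun β a => β ^ j * F β a) := by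
  have hj : UnifO j (fun (β : ℂ) (_ : α) => β ^ j) :=
    ⟨1, 1, one_pos, fun β _ _ => by rw [norm_pow, one_mul]⟩
  exact hj.mul hF

/-- Reindexing the parameter. [folklore] -/
theorem comp {α' : Type*} (φ : α' → α) (hF : UnifO k F) : UnifO k (fun β a => F β (φ a)) := by
  obtain ⟨C, r, hr, h⟩ := hF
  exact ⟨C, r, hr, fun β hβ a => h β hβ (φ a)⟩

/-- A scalar function which is `O(βᵏ)` at `0` is a (constant-in-`a`) `UnifO k` family. [folklore] -/
theorem of_isBigO {f : ℂ → ℂ} (hf : f =O[𝓝 (0 : ℂ)] fun β => β ^ k) :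
    UnifO k (fun (β : ℂ) (_ : α) => f β) := by
  obtain ⟨C, hC⟩ := hf.bound
  obtain ⟨r, hr, hball⟩ := Metric.eventually_nhds_iff.1 hC
  refine ⟨C, r, hr, fun β hβ _ => ?_⟩
  have h := hball (by rwa [dist_zero_right])
  rwa [norm_pow] at h

/-- A scalar function bounded near `0` is a `UnifO 0` family. [folklore] -/
theorem of_bddAt {f : ℂ → ℂ} (hf : BddAt f) : UnifO 0 (fun (β : ℂ) (_ : α) => f β) :=
  of_isBigO (hf.congr_right fun β => (pow_zero β).symm)

/-- Evaluating at one parameter gives an honest `O(βᵏ)`. [folklore] -/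
theorem isBigO_eval (hF : UnifO k F) (a : α) :
    (fun β => F β a) =O[𝓝 (0 : ℂ)] fun β => β ^ k := by
  obtain ⟨C, r, hr, h⟩ := hF
  refine IsBigO.of_bound C ?_
  filter_upwards [Metric.ball_mem_nhds (0 : ℂ) hr] with β hβ
  rw [Metric.mem_ball, dist_zero_right] at hβ
  rw [norm_pow]
  exact h β hβ a

/-- **Integration.**  A `UnifO k` family integrated against a probability measure is `O(βᵏ)` at
`β = 0` (no measurability needed: a non-integrable section integrates to `0`). [folklore] -/
theorem isBigO_integral [MeasurableSpace α] (ν : Measure α) [IsProbabilityMeasure ν]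
    (hF : UnifO k F) : (fun β => ∫ a, F β a ∂ν) =O[𝓝 (0 : ℂ)] fun β => β ^ k := by
  obtain ⟨C, r, hr, h⟩ := hF
  refine IsBigO.of_bound C ?_
  filter_upwards [Metric.ball_mem_nhds (0 : ℂ) hr] with β hβ
  rw [Metric.mem_ball, dist_zero_right] at hβ
  rw [norm_pow]
  have hI := norm_integral_le_of_norm_le_const (μ := ν) (Eventually.of_forall (h β hβ))
  simpa using hI

/-- **Finite products**: the orders add up. [folklore] -/
theorem prod {ι : Type*} [DecidableEq ι] (S : Finset ι) {kf : ι → ℕ} {Ff : ι → ℂ → α → ℂ}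
    (h : ∀ i ∈ S, UnifO (kf i) (Ff i)) :
    UnifO (∑ i ∈ S, kf i) (fun β a => ∏ i ∈ S, Ff i β a) := by
  induction S using Finset.induction_on with
  | empty =>
      simp only [sum_empty, prod_empty]
      exact of_norm_le (C := 1) fun _ _ => by simp
  | insert i S hi ih =>
      have h1 : UnifO (kf i) (Ff i) := h i (mem_insert_self _ _)
      have h2 := ih fun i' hi' => h i' (mem_insert_of_mem hi')
      have h12 := h1.mul h2
      simpa [sum_insert hi, prod_insert hi] using h12

/-- A family with a leading term `βᵏ P` (`P` bounded) is itself `UnifO k`. [folklore] -/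
theorem of_leading {P : α → ℂ} {M : ℝ} (hP : ∀ a, ‖P a‖ ≤ M)
    (h : UnifO (k + 1) (fun β a => F β a - β ^ k * P a)) : UnifO k F := by
  have hPk : UnifO k (fun (β : ℂ) (a : α) => β ^ k * P a) := by
    have h0 : UnifO 0 (fun (_ : ℂ) (a : α) => P a) := of_norm_le fun _ a => hP a
    simpa using h0.pow_mul k
  have hsum := (h.mono (Nat.le_succ k)).add hPk
  simpa only [sub_add_cancel] using hsum

/-- **Products of families with leading terms.**  If `F_i = βᵏ P_i + UnifO(k+1)` on `S` with the
`P_i` uniformly bounded, then `∏_{i∈S} F_i = β^{k #S} ∏_{i∈S} P_i + UnifO(k #S + 1)`. [folklore] -/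
theorem prod_leading {ι : Type*} [DecidableEq ι] (S : Finset ι) {Ff : ι → ℂ → α → ℂ}
    {P : ι → α → ℂ} {M : ℝ} (hP : ∀ i ∈ S, ∀ a, ‖P i a‖ ≤ M)
    (h : ∀ i ∈ S, UnifO (k + 1) (fun β a => Ff i β a - β ^ k * P i a)) :
    UnifO (k * S.card + 1)
      (fun β a => ∏ i ∈ S, Ff i β a - β ^ (k * S.card) * ∏ i ∈ S, P i a) := by
  induction S using Finset.induction_on with
  | empty =>
      simp only [prod_empty, card_empty, mul_zero, pow_zero, mul_one, sub_self]
      exact zero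
  | insert i S hi ih =>
      have hPi : ∀ a, ‖P i a‖ ≤ M := hP i (mem_insert_self _ _)
      have hFi : UnifO (k + 1) (fun β a => Ff i β a - β ^ k * P i a) := h i (mem_insert_self _ _)
      have ih' := ih (fun i' hi' => hP i' (mem_insert_of_mem hi'))
        (fun i' hi' => h i' (mem_insert_of_mem hi'))
      -- the tail product is `UnifO (k #S)`
      have hPS : ∀ a, ‖∏ i' ∈ S, P i' a‖ ≤ M ^ S.card := fun a => by
        rw [norm_prod]
        calc ∏ i' ∈ S, ‖P i' a‖ ≤ ∏ _i' ∈ S, M :=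
              prod_le_prod (fun _ _ => norm_nonneg _) fun i' hi' => hP i' (mem_insert_of_mem hi') a
          _ = M ^ S.card := prod_const M
      have htail : UnifO (k * S.card) (fun β a => ∏ i' ∈ S, Ff i' β a) := of_leading hPS ih'
      -- split `F_i ∏_S F − β^{k(#S+1)} P_i ∏_S P`
      have hA := hFi.mul htail
      have hB : UnifO (k + (k * S.card + 1))
          (fun β a => β ^ k * P i a * (∏ i' ∈ S, Ff i' β a - β ^ (k * S.card) * ∏ i' ∈ S, P i' a)) := by
        have h0 : UnifO 0 (fun (_ : ℂ) (a : α) => P i a) := of_norm_le fun _ a => hPi a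
        have h1 : UnifO k (fun (β : ℂ) (a : α) => β ^ k * P i a) := by simpa using h0.pow_mul k
        exact h1.mul ih'
      have hB' : UnifO (k * (insert i S).card + 1)
          (fun β a => β ^ k * P i a * (∏ i' ∈ S, Ff i' β a - β ^ (k * S.card) * ∏ i' ∈ S, P i' a)) := by
        rw [card_insert_of_notMem hi]
        convert hB using 1
        ring
      have hA' : UnifO (k * (insert i S).card + 1)
          (fun β a => (Ff i β a - β ^ k * P i a) * ∏ i' ∈ S, Ff i' β a) := by
        refine hA.mono ?_
        rw [card_insert_of_notMem hi]
        nlinarith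
      have hsum := hA'.add hB'
      have heq : (fun β a => ∏ i' ∈ insert i S, Ff i' β a -
          β ^ (k * (insert i S).card) * ∏ i' ∈ insert i S, P i' a) =
          (fun β a => (Ff i β a - β ^ k * P i a) * ∏ i' ∈ S, Ff i' β a +
            β ^ k * P i a * (∏ i' ∈ S, Ff i' β a - β ^ (k * S.card) * ∏ i' ∈ S, P i' a)) := by
        funext β a
        rw [prod_insert hi, prod_insert hi, card_insert_of_notMem hi]
        ring
      rw [heq]
      exact hsum

end UnifO

/-! ## Division by the squared normaliser -/

/-- **`N / Z² − b βᵐ = O(β^{m+1})`** from `N − b βᵐ = O(β^{m+1})`, `Z − 1 = O(β)` and `Z⁻¹` bounded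
near `0` (the tilted covariance is the doubled numerator over the squared normaliser, which tends
to `1`). [folklore] -/
theorem isBigO_div_sq_sub {N Z : ℂ → ℂ} {b : ℂ} {m : ℕ}
    (hN : (fun β => N β - b * β ^ m) =O[𝓝 (0 : ℂ)] fun β => β ^ (m + 1))
    (hZ : (fun β => Z β - 1) =O[𝓝 (0 : ℂ)] fun β => β ^ 1) (hZinv : BddAt fun β => (Z β)⁻¹)
    (hZne : ∀ᶠ β in 𝓝 (0 : ℂ), Z β ≠ 0) :
    (fun β => N β / Z β ^ 2 - b * β ^ m) =O[𝓝 (0 : ℂ)] fun β => β ^ (m + 1) := by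
  have hinv2 : BddAt fun β => (Z β)⁻¹ ^ 2 := by simpa [pow_two] using hZinv.mul hZinv
  have hZb : BddAt Z := by
    have h1 : BddAt fun β => Z β - 1 := BddAt.of_isBigO_pow hZ
    have h2 := h1.add (BddAt.const 1)
    simpa using h2
  -- `N/Z² − bβᵐ = (N − bβᵐ) Z⁻² + bβᵐ (1 − Z)(1 + Z) Z⁻²`
  have hA : (fun β => (N β - b * β ^ m) * (Z β)⁻¹ ^ 2) =O[𝓝 (0 : ℂ)] fun β => β ^ (m + 1) := by
    have h := hN.mul hinv2
    simpa using h
  have hB : (fun β => b * β ^ m * ((1 - Z β) * (1 + Z β) * (Z β)⁻¹ ^ 2)) =O[𝓝 (0 : ℂ)]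
      fun β => β ^ (m + 1) := by
    have h1 : (fun β => 1 - Z β) =O[𝓝 (0 : ℂ)] fun β => β ^ 1 := by
      simpa using hZ.neg_left
    have h2 : BddAt fun β => (1 + Z β) * (Z β)⁻¹ ^ 2 := ((BddAt.const 1).add hZb).mul hinv2
    have h12 := h1.mul h2
    have hbm := (isBigO_const_mul_self b (fun β : ℂ => β ^ m) (𝓝 (0 : ℂ))).mul h12
    refine (hbm.congr_left fun β => by ring).congr_right fun β => by ring
  refine (hA.add hB).congr' ?_ EventuallyEq.rfl
  filter_upwards [hZne] with β hβ
  have h2 : (Z β)⁻¹ ^ 2 * Z β ^ 2 = 1 := by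
    rw [← mul_pow, inv_mul_cancel₀ hβ, one_pow]
  rw [div_eq_mul_inv, ← inv_pow]
  linear_combination (-(b * β ^ m)) * h2

end Summit.Ventures.LatticeQCDFlow.Theory2

end
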